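/-
Copyright (c) 2026 the pub-hodgecm-mathlib formalisation cell (harness21).  Prover seat hodgecm-mathlib-K2E3-p17 (g7), Track B «K2-LIT» ∕ h413
(`stmt-HodgeConjecture-24833`), line `K2_E3_EllipticInputs`, unit U12 §L, road «GL-[M6]-sc» (owner K2E3-p23 (g5)), RULINGS #16 (M16-1): T15 (`hW`) IN DOMINATION
FORM AT `G' = GL₃(F) ⧸ ϖ^ℤ·1` — «`x ↦ 1[Z_{G'}(x) not compact] · |D♮(x)|^{-(1/2+ε)}` is locally integrable for every Haar measure of `G'`» (Harish-Chandra's Theorem 15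
for the two non-elliptic Cartan types of `GL₃`, modulo the discrete cocompact centre).  2026-09-04.
-/
import Summits.HodgeConjecture.HodgeConjecture.Theorems.K2E3GL3ModUniformizerLocIntTransfer        -- ★ p858329 (this seat): T15 transport at `G'`, `locallyIntegrableOn_mul_continuousOn`
import Summits.HodgeConjecture.HodgeConjecture.Theorems.K2E3GL3SplitDiscriminantLocIntegrable      -- ★ p858251 (this seat): T15 split half on `𝔤𝔩₃(F)`
import Summits.HodgeConjecture.HodgeConjecture.Theorems.K2E3GL3MixedDiscriminantLocIntegrable      -- ★ p858354 (K2E3-p11 (g5)): T15 mixed half on `𝔤𝔩₃(F)`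
import Summits.HodgeConjecture.HodgeConjecture.Theorems.K2E3GL3ModUniformizerCentralizerCompact    -- ★ B4-1d p857969: `isCompact_centralizer_mk_iff_irreducible`, `not_isCompact_centralizer_mk_of_not_irreducible`
import HarnessLib

/-!
# K2_E3 road (h413), §L — T15 AT `G'`: `1[¬ IsCompact Z_{G'}(x)] · |D♮(x)|^{-(1/2+ε)} ∈ L¹_loc(G', μ')`, `|D♮(mk g)| = ‖disc χ_g‖_F ∕ ‖det g‖_F²`

Cell `pub/hodgecm-mathlib` (D-0151), Track B, seat K2E3-p17 (g7); road owner K2E3-p23 (g5) RULINGS #16 (M16-1): «deliver `hW` in DOMINATION FORM at `G'`, so ASM can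
build its own weight: `LocallyIntegrable (fun x => 1[¬IsCompact Z(x)]·(δ x)^{-(1/2+ε)}) μ'` where `δ : G' → ℝ≥0` is ANY function with `δ (mk g) = ‖disc χ_g‖ ∕ ‖det g‖²`
(quantified, no `def`), `0 < ε < 1/8`».  `--supports stmt-HodgeConjecture-24833 --as helper`; THEOREMS ONLY (no definition ∕ instance ∕ notation ∕ named fact ∕ `sorry`);
never imports `Cruxes/…/Lines`.  COUNT-NEUTRAL.

THE MATHEMATICS.  §1 (Lie algebra, upstairs): `X ↦ 1[disc χ_X ≠ 0, #roots_F χ_X ∈ {3, 1}] · ‖disc χ_X‖^{-(1/2+ε)} · ‖det X‖^s` is locally integrable ON the invertible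
matrices for every real `s` and `0 < ε < 1/8` (★ split half `ε < 1/4` + ★ mixed half `0 < ε < 1/8`, restricted to the open set `{IsUnit}`, times the continuous
nonvanishing `‖det‖^s`).  §2 (at `G'`): for `x = mk g` with `disc χ_g ≠ 0`, `Z_{G'}(x)` is non-compact iff `χ_g` is reducible iff `#roots ∈ {3, 1}` (★ B4-1d); with
`|D♮(x)| = ‖disc χ_g‖∕‖det g‖²`, `1[¬cpt]·|D♮|^{-(1/2+ε)}` composed with `mk` is EXACTLY the §1 function at `s = 1 + 2ε` (and both vanish where `disc χ_g = 0`, the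
exponent being non-zero); it is Borel measurable (it equals the indicator of the OPEN image `mk {disc ≠ 0 ∧ #roots ∈ {3,1}}` times the continuous `δ^{-(1/2+ε)}`), so
★ `locallyIntegrable_of_norm_comp_mk_le` (Haar of `GL₃ = a‖det‖⁻³dX` on `M₃`; covering transport `GL₃ → G'` through `GL₃(𝒪)`) gives local integrability on `G'`.
[HarishChandra1970, Part V §6 Thm. 15 p. 63, Part VII §3 pp. 71–73] [HarishChandra1999AdmissibleDistributions, §15]
HONEST LABEL: HC_CM is proved only modulo the 7 printed citations (2 remaining named inputs: hLiu418 = stmt-HodgeConjecture-24832, h413 = stmt-HodgeConjecture-24833)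
until rung 0 closes; count-neutral helper (the elliptic classes, `IsCompact Z`, are paid by ★ B3 and carry weight `0` here).

## Mathlib ∕ tree search
Tree: ★ `K2E3GL3SplitDiscriminantLocIntegrable.locallyIntegrable_indicator_split_rpow_neg`, ★ `K2E3GL3MixedDiscriminantLocIntegrable.locallyIntegrable_indicator_mixed_rpow_neg`,
★ `K2E3GL3ModUniformizerLocIntTransfer.{locallyIntegrable_of_norm_comp_mk_le, locallyIntegrableOn_mul_continuousOn}`, ★ `K2E3HaarLocallyIntegrableTransport.setOf_isUnit_eq_range`,
★ B4-1d `K2E3GL3ModUniformizerCentralizerCompact.{isCompact_centralizer_mk_iff_irreducible, not_isCompact_centralizer_mk_of_not_irreducible}`, ★ B4-1d-1 (T1)∕(T2),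
★ `separable_of_discr_ne_zero`, ★ `isOpen_setOf_charpoly_discr_ne_zero_and_card_roots_eq`, ★ `continuous_discr_charpoly`, ★ `continuous_normAbs`, ★ `isOpenEmbedding_generalLinearGroup_val`.
Mathlib: `QuotientGroup.isQuotientMap_mk`, `IsQuotientMap.continuous_iff`, `QuotientGroup.isOpenMap_coe`, `Real.div_rpow`, `Real.rpow_neg`, `Real.rpow_mul`, `Real.zero_rpow`,
`ContinuousOn.rpow_const`.  Dedup: `rg "not_isCompact_centralizer.*rpow|NonEllWeight"` over Literature∕Summits — no hits.

## References
* [HarishChandra1970] Harish-Chandra (van Dijk), *Harmonic Analysis on Reductive p-adic Groups*, LNM 162 (1970), Part V §6 Thm. 15, Part VII §3.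
* [HarishChandra1999AdmissibleDistributions] Harish-Chandra (DeBacker–Sally), *Admissible Invariant Distributions on Reductive p-adic Groups* (1999), §15.
-/

set_option autoImplicit false
set_option linter.dupNamespace false

noncomputable section

open MeasureTheory MeasureTheory.Measure Set Function Topology Filter Polynomial
open scoped NNReal ENNReal MatrixGroups WithZero Valued
open Literature.NumberTheory.GaloisRepresentations Literature.NumberTheory.GaloisRepresentations.IsNonarchimedeanLocalField
open Literature.NumberTheory.Automorphic Literature.NumberTheory.Automorphic.LocalFieldHaar
open Summit.HodgeConjecture.HodgeConjecture.Cruxes.H413.K2E3CharpolyRootsPerturbation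
open Summit.HodgeConjecture.HodgeConjecture.Cruxes.H413.K2E3CubicRationalRootsLocallyConstant
open Summit.HodgeConjecture.HodgeConjecture.Cruxes.H413.K2E3GL3ModUniformizerCentralizerTrichotomy
open Summit.HodgeConjecture.HodgeConjecture.Cruxes.H413.K2E3GL3ModUniformizerCentralizerCompact
open Summit.HodgeConjecture.HodgeConjecture.Cruxes.H413.K2E3HaarLocallyIntegrableTransport
open Summit.HodgeConjecture.HodgeConjecture.Cruxes.H413.K2E3GL3ModUniformizerLocIntTransfer
open Summit.HodgeConjecture.HodgeConjecture.Cruxes.H413.K2E3GL3ModCentre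

namespace Summit.HodgeConjecture.HodgeConjecture.Cruxes.H413.K2E3GL3NonEllWeightLocIntegrable

/-! ## §1  Upstairs: `1[disc ≠ 0, #roots ∈ {3,1}] · ‖disc χ‖^{-(1/2+ε)} · ‖det‖^s` is locally integrable on the invertible matrices -/

section Upstairs

variable {F : Type*} [Field F] [ValuativeRel F] [TopologicalSpace F] [IsNonarchimedeanLocalField F]
variable [MeasurableSpace (Matrix (Fin 3) (Fin 3) F)] [BorelSpace (Matrix (Fin 3) (Fin 3) F)]

/-- **T15 upstairs, both non-elliptic Cartan types, with a `‖det‖`-power**: for `0 < ε < 1/8`, every real `s` and every additive Haar measure `dX` of `𝔤𝔩₃(F)`,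
`X ↦ 1[disc χ_X ≠ 0 ∧ #roots_F χ_X ∈ {3, 1}] · ‖disc χ_X‖_F^{-(1/2+ε)} · ‖det X‖_F^s` is locally integrable on `{X | IsUnit X}` (★ split + ★ mixed halves; `‖det‖^s` is
continuous on the invertible matrices). [cite: HarishChandra1970, Part V §6 Thm. 15 p. 63] [cite: HarishChandra1999AdmissibleDistributions, §15] -/
theorem locallyIntegrableOn_indicator_nonell_rpow_neg_mul_det_rpow (h2 : (2 : F) ≠ 0) (dX : Measure (Matrix (Fin 3) (Fin 3) F)) [dX.IsAddHaarMeasure]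
    {ε : ℝ} (hε0 : 0 < ε) (hε : ε < 1 / 8) (s : ℝ) :
    LocallyIntegrableOn (fun X : Matrix (Fin 3) (Fin 3) F =>
      {Y : Matrix (Fin 3) (Fin 3) F | Y.charpoly.discr ≠ 0 ∧ (Y.charpoly.roots.card = 3 ∨ Y.charpoly.roots.card = 1)}.indicator
          (fun Y => ((normAbs F Y.charpoly.discr : ℝ)) ^ (-(1 / 2 + ε))) X * ((normAbs F X.det : ℝ)) ^ s)
      {X : Matrix (Fin 3) (Fin 3) F | IsUnit X} dX := by
  classical
  haveI : T2Space F := (isLocalField F).toT2Space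
  haveI : LocallyCompactSpace F := (isLocalField F).toLocallyCompactSpace
  haveI : IsTopologicalRing F := inferInstance
  haveI : T2Space (Matrix (Fin 3) (Fin 3) F) := inferInstanceAs (T2Space (Fin 3 → Fin 3 → F))
  haveI : LocallyCompactSpace (Matrix (Fin 3) (Fin 3) F) := Pi.locallyCompactSpace_of_finite
  -- the non-elliptic indicator is the sum of the split and mixed indicators
  have hsum : (fun X : Matrix (Fin 3) (Fin 3) F =>
      {Y : Matrix (Fin 3) (Fin 3) F | Y.charpoly.discr ≠ 0 ∧ (Y.charpoly.roots.card = 3 ∨ Y.charpoly.roots.card = 1)}.indicator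
        (fun Y => ((normAbs F Y.charpoly.discr : ℝ)) ^ (-(1 / 2 + ε))) X) =
      fun X => {Y : Matrix (Fin 3) (Fin 3) F | Y.charpoly.discr ≠ 0 ∧ Y.charpoly.roots.card = 3}.indicator
          (fun Y => ((normAbs F Y.charpoly.discr : ℝ)) ^ (-(1 / 2 + ε))) X +
        {Y : Matrix (Fin 3) (Fin 3) F | Y.charpoly.discr ≠ 0 ∧ Y.charpoly.roots.card = 1}.indicator
          (fun Y => ((normAbs F Y.charpoly.discr : ℝ)) ^ (-(1 / 2 + ε))) X := by
    funext X
    by_cases hD : X.charpoly.discr = 0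
    · simp [hD]
    · by_cases h3 : X.charpoly.roots.card = 3
      · have h1 : ¬ X.charpoly.roots.card = 1 := by omega
        simp [hD, h3]
      · by_cases h1 : X.charpoly.roots.card = 1
        · simp [hD, h1]
        · simp [hD, h3, h1]
  have hloc : LocallyIntegrable (fun X : Matrix (Fin 3) (Fin 3) F =>
      {Y : Matrix (Fin 3) (Fin 3) F | Y.charpoly.discr ≠ 0 ∧ (Y.charpoly.roots.card = 3 ∨ Y.charpoly.roots.card = 1)}.indicator
        (fun Y => ((normAbs F Y.charpoly.discr : ℝ)) ^ (-(1 / 2 + ε))) X) dX := by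
    rw [hsum]
    exact (K2E3GL3SplitDiscriminantLocIntegrable.locallyIntegrable_indicator_split_rpow_neg dX (by linarith)).add
      (K2E3GL3MixedDiscriminantLocIntegrable.locallyIntegrable_indicator_mixed_rpow_neg h2 dX hε0 hε)
  -- the open set of invertible matrices and the continuous factor `‖det‖^s`
  have hUo : IsOpen {X : Matrix (Fin 3) (Fin 3) F | IsUnit X} := by
    rw [setOf_isUnit_eq_range]; exact (isOpenEmbedding_generalLinearGroup_val (m := Fin 3) (F := F)).isOpen_range
  have hdetc : Continuous fun X : Matrix (Fin 3) (Fin 3) F => (normAbs F X.det : ℝ) :=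
    continuous_subtype_val.comp (continuous_normAbs.comp continuous_id.matrix_det)
  have hcont : ContinuousOn (fun X : Matrix (Fin 3) (Fin 3) F => ((normAbs F X.det : ℝ)) ^ s) {X : Matrix (Fin 3) (Fin 3) F | IsUnit X} :=
    hdetc.continuousOn.rpow_const fun X hX =>
      Or.inl (NNReal.coe_pos.2 (pos_iff_ne_zero.2 ((map_ne_zero (normAbs F)).2 ((Matrix.isUnit_iff_isUnit_det X).1 hX).ne_zero))).ne'
  exact locallyIntegrableOn_mul_continuousOn hUo (hloc.locallyIntegrableOn _) hcont

end Upstairs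

/-! ## §2  At `G' = GL₃(F) ⧸ ϖ^ℤ·1`: `1[¬ IsCompact Z(x)] · |D♮(x)|^{-(1/2+ε)}` is locally integrable -/

section Quotient

variable {F : Type*} [Field F] [Valued F ℤᵐ⁰] [ValuativeRel F] [(Valued.v : Valuation F ℤᵐ⁰).Compatible] [IsNonarchimedeanLocalField F] [CharZero F]

/-- **T15 AT `G'` IN DOMINATION FORM (RULINGS #16 (M16-1))**: for `F` a characteristic-`0` non-archimedean local field with uniformizer `ϖ`,
`G' = GL₃(F) ⧸ ϖ^ℤ·1`, EVERY Haar measure `μ'` of `G'`, every `δ : G' → ℝ≥0` with `δ (mk g) = ‖disc χ_g‖_F ∕ ‖det g‖_F²` (`= |D♮(g)|`) and `0 < ε < 1/8`: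
`x ↦ 1[Z_{G'}(x) is not compact] · (δ x)^{-(1/2+ε)}` is locally `μ'`-integrable (Harish-Chandra's Theorem 15 for the split torus `A` and the mixed tori `E^× × F^×` of
`GL₃`, modulo the centre; the compact-centraliser = elliptic classes carry weight `0`). [cite: HarishChandra1970, Part V §6 Thm. 15 p. 63, Part VII §3 pp. 71–73]
[cite: HarishChandra1999AdmissibleDistributions, §15] -/
theorem locallyIntegrable_indicator_not_isCompact_centralizer_rpow_neg {ϖ : F} (hϖ : Valued.v ϖ = WithZero.exp (-1 : ℤ)) (hϖ0 : ϖ ≠ 0)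
    [((Subgroup.zpowers (Units.mk0 ϖ hϖ0)).map (Matrix.GeneralLinearGroup.scalar (Fin 3))).Normal]
    [MeasurableSpace (GL (Fin 3) F ⧸ (Subgroup.zpowers (Units.mk0 ϖ hϖ0)).map (Matrix.GeneralLinearGroup.scalar (Fin 3)))]
    [BorelSpace (GL (Fin 3) F ⧸ (Subgroup.zpowers (Units.mk0 ϖ hϖ0)).map (Matrix.GeneralLinearGroup.scalar (Fin 3)))]
    (μ' : Measure (GL (Fin 3) F ⧸ (Subgroup.zpowers (Units.mk0 ϖ hϖ0)).map (Matrix.GeneralLinearGroup.scalar (Fin 3)))) [μ'.IsHaarMeasure]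
    (δ : GL (Fin 3) F ⧸ (Subgroup.zpowers (Units.mk0 ϖ hϖ0)).map (Matrix.GeneralLinearGroup.scalar (Fin 3)) → ℝ≥0)
    (hδ : ∀ g : GL (Fin 3) F, δ (QuotientGroup.mk g) =
      normAbs F (g : Matrix (Fin 3) (Fin 3) F).charpoly.discr / normAbs F (g : Matrix (Fin 3) (Fin 3) F).det ^ 2)
    {ε : ℝ} (hε0 : 0 < ε) (hε : ε < 1 / 8) :
    LocallyIntegrable (fun x : GL (Fin 3) F ⧸ (Subgroup.zpowers (Units.mk0 ϖ hϖ0)).map (Matrix.GeneralLinearGroup.scalar (Fin 3)) =>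
      {y : GL (Fin 3) F ⧸ (Subgroup.zpowers (Units.mk0 ϖ hϖ0)).map (Matrix.GeneralLinearGroup.scalar (Fin 3)) |
          ¬ IsCompact ((Subgroup.centralizer ({y} : Set (GL (Fin 3) F ⧸ (Subgroup.zpowers (Units.mk0 ϖ hϖ0)).map (Matrix.GeneralLinearGroup.scalar (Fin 3))))) :
            Set (GL (Fin 3) F ⧸ (Subgroup.zpowers (Units.mk0 ϖ hϖ0)).map (Matrix.GeneralLinearGroup.scalar (Fin 3))))}.indicator
        (fun y => ((δ y : ℝ)) ^ (-(1 / 2 + ε))) x) μ' := by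
  classical
  -- §0 frame
  haveI : IsTopologicalRing F := inferInstance
  haveI : T2Space F := (isLocalField F).toT2Space
  haveI : LocallyCompactSpace F := (isLocalField F).toLocallyCompactSpace
  haveI : T2Space (Matrix (Fin 3) (Fin 3) F) := inferInstanceAs (T2Space (Fin 3 → Fin 3 → F))
  haveI : LocallyCompactSpace (Matrix (Fin 3) (Fin 3) F) := Pi.locallyCompactSpace_of_finite
  haveI : SecondCountableTopology (GL (Fin 3) F) := secondCountableTopology_gl3 F
  haveI : LocallyCompactSpace (GL (Fin 3) F) := locallyCompactSpace_gl3 F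
  letI : MeasurableSpace (GL (Fin 3) F) := borel _
  haveI : BorelSpace (GL (Fin 3) F) := ⟨rfl⟩
  letI : MeasurableSpace (Matrix (Fin 3) (Fin 3) F) := borel _
  haveI : BorelSpace (Matrix (Fin 3) (Fin 3) F) := ⟨rfl⟩
  letI : MeasurableSpace F := borel F
  haveI : BorelSpace F := ⟨rfl⟩
  set ρ : Measure (GL (Fin 3) F) := Measure.haar with hρ
  set dX : Measure (Matrix (Fin 3) (Fin 3) F) := Measure.addHaar with hdX
  -- names
  set NE : Set (Matrix (Fin 3) (Fin 3) F) :=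
    {Y : Matrix (Fin 3) (Fin 3) F | Y.charpoly.discr ≠ 0 ∧ (Y.charpoly.roots.card = 3 ∨ Y.charpoly.roots.card = 1)} with hNE
  set U : Set (GL (Fin 3) F ⧸ (Subgroup.zpowers (Units.mk0 ϖ hϖ0)).map (Matrix.GeneralLinearGroup.scalar (Fin 3))) := {y | ¬ IsCompact ((Subgroup.centralizer ({y} : Set (GL (Fin 3) F ⧸ (Subgroup.zpowers (Units.mk0 ϖ hϖ0)).map (Matrix.GeneralLinearGroup.scalar (Fin 3))))) : Set (GL (Fin 3) F ⧸ (Subgroup.zpowers (Units.mk0 ϖ hϖ0)).map (Matrix.GeneralLinearGroup.scalar (Fin 3))))} with hU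
  set f : GL (Fin 3) F ⧸ (Subgroup.zpowers (Units.mk0 ϖ hϖ0)).map (Matrix.GeneralLinearGroup.scalar (Fin 3)) → ℝ := fun y => ((δ y : ℝ)) ^ (-(1 / 2 + ε)) with hf
  set O : Set (GL (Fin 3) F ⧸ (Subgroup.zpowers (Units.mk0 ϖ hϖ0)).map (Matrix.GeneralLinearGroup.scalar (Fin 3))) := {y | ∃ g : GL (Fin 3) F, (QuotientGroup.mk g : GL (Fin 3) F ⧸ (Subgroup.zpowers (Units.mk0 ϖ hϖ0)).map (Matrix.GeneralLinearGroup.scalar (Fin 3))) = y ∧ (g : Matrix (Fin 3) (Fin 3) F) ∈ NE} with hO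
  have hexp : (-(1 / 2 + ε) : ℝ) ≠ 0 := by linarith
  -- §1 `O` is open (image of an open set under the open map `mk`)
  have hNEo : IsOpen NE := by
    have h : NE = {Y : Matrix (Fin 3) (Fin 3) F | Y.charpoly.discr ≠ 0 ∧ Y.charpoly.roots.card = 3} ∪
        {Y : Matrix (Fin 3) (Fin 3) F | Y.charpoly.discr ≠ 0 ∧ Y.charpoly.roots.card = 1} := by
      ext Y; simp only [hNE, mem_setOf_eq, mem_union]; tauto
    rw [h]
    exact (isOpen_setOf_charpoly_discr_ne_zero_and_card_roots_eq 3).union (isOpen_setOf_charpoly_discr_ne_zero_and_card_roots_eq 1)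
  have hOeq : O = (QuotientGroup.mk : GL (Fin 3) F → GL (Fin 3) F ⧸ (Subgroup.zpowers (Units.mk0 ϖ hϖ0)).map (Matrix.GeneralLinearGroup.scalar (Fin 3))) '' {g : GL (Fin 3) F | (g : Matrix (Fin 3) (Fin 3) F) ∈ NE} := by
    ext y
    simp only [hO, mem_setOf_eq, mem_image]
    constructor
    · rintro ⟨g, hg, hgNE⟩; exact ⟨g, hgNE, hg⟩
    · rintro ⟨g, hgNE, hg⟩; exact ⟨g, hg, hgNE⟩
  have hOo : IsOpen O := by
    rw [hOeq]
    exact QuotientGroup.isOpenMap_coe _ (hNEo.preimage Units.continuous_val)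
  -- §2 `δ` is continuous (its composite with `mk` is)
  have hφc : Continuous fun g : GL (Fin 3) F =>
      normAbs F (g : Matrix (Fin 3) (Fin 3) F).charpoly.discr / normAbs F (g : Matrix (Fin 3) (Fin 3) F).det ^ 2 := by
    refine Continuous.div ?_ ?_ fun g => ?_
    · exact continuous_normAbs.comp ((F0P3cStCharTSHCDGroupToLie.continuous_discr_charpoly (K := F)).comp Units.continuous_val)
    · exact (continuous_normAbs.comp (Units.continuous_val.matrix_det)).pow 2
    · exact pow_ne_zero 2 ((map_ne_zero (normAbs F)).2 ((Matrix.isUnit_iff_isUnit_det _).1 g.isUnit).ne_zero)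
  have hδc : Continuous δ := by
    rw [(QuotientGroup.isQuotientMap_mk ((Subgroup.zpowers (Units.mk0 ϖ hϖ0)).map (Matrix.GeneralLinearGroup.scalar (Fin 3)))).continuous_iff]
    have h : δ ∘ (QuotientGroup.mk : GL (Fin 3) F → GL (Fin 3) F ⧸ (Subgroup.zpowers (Units.mk0 ϖ hϖ0)).map (Matrix.GeneralLinearGroup.scalar (Fin 3))) = fun g : GL (Fin 3) F =>
        normAbs F (g : Matrix (Fin 3) (Fin 3) F).charpoly.discr / normAbs F (g : Matrix (Fin 3) (Fin 3) F).det ^ 2 :=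
      funext fun g => by rw [Function.comp_apply]; exact hδ g
    rw [h]; exact hφc
  have hfm : Measurable f := (continuous_subtype_val.comp hδc).measurable.pow_const _
  -- §3 the weight equals `1_O · f` pointwise
  have hkey : ∀ g : GL (Fin 3) F, (g : Matrix (Fin 3) (Fin 3) F).charpoly.discr ≠ 0 →
      ((QuotientGroup.mk g : GL (Fin 3) F ⧸ (Subgroup.zpowers (Units.mk0 ϖ hϖ0)).map (Matrix.GeneralLinearGroup.scalar (Fin 3))) ∈ U ↔ (QuotientGroup.mk g : GL (Fin 3) F ⧸ (Subgroup.zpowers (Units.mk0 ϖ hϖ0)).map (Matrix.GeneralLinearGroup.scalar (Fin 3))) ∈ O) := by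
    intro g hD
    have hsep : (g : Matrix (Fin 3) (Fin 3) F).charpoly.Separable :=
      separable_of_discr_ne_zero (Matrix.charpoly_monic _) (by rw [Matrix.charpoly_natDegree_eq_dim, Fintype.card_fin]; norm_num) hD
    constructor
    · intro hU'
      have hirr : ¬ Irreducible (g : Matrix (Fin 3) (Fin 3) F).charpoly := fun hirr =>
        hU' ((isCompact_centralizer_mk_iff_irreducible hϖ hϖ0 g hsep).2 hirr)
      rw [irreducible_charpoly_iff_card_roots_eq_zero] at hirr
      refine ⟨g, rfl, hD, ?_⟩
      rcases card_roots_charpoly_eq_zero_or_one_or_three (g : Matrix (Fin 3) (Fin 3) F) with h | h | h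
      · exact absurd h hirr
      · exact Or.inr h
      · exact Or.inl h
    · rintro ⟨g', hg', hD', hcard'⟩
      have hsep' : (g' : Matrix (Fin 3) (Fin 3) F).charpoly.Separable :=
        separable_of_discr_ne_zero (Matrix.charpoly_monic _) (by rw [Matrix.charpoly_natDegree_eq_dim, Fintype.card_fin]; norm_num) hD'
      have hirr' : ¬ Irreducible (g' : Matrix (Fin 3) (Fin 3) F).charpoly := by
        rw [irreducible_charpoly_iff_card_roots_eq_zero]; omega
      rw [← hg']
      exact not_isCompact_centralizer_mk_of_not_irreducible hϖ hϖ0 g' hsep' hirr'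
  have hWeq : (fun x : GL (Fin 3) F ⧸ (Subgroup.zpowers (Units.mk0 ϖ hϖ0)).map (Matrix.GeneralLinearGroup.scalar (Fin 3)) => U.indicator f x) = fun x => O.indicator f x := by
    funext x
    obtain ⟨g, rfl⟩ := QuotientGroup.mk_surjective x
    by_cases hD : (g : Matrix (Fin 3) (Fin 3) F).charpoly.discr = 0
    · -- `δ (mk g) = 0`, so both sides vanish
      have hδ0 : δ (QuotientGroup.mk g) = 0 := by rw [hδ g, hD, map_zero, zero_div]
      have hf0 : f (QuotientGroup.mk g) = 0 := by simp only [hf, hδ0, NNReal.coe_zero, Real.zero_rpow hexp]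
      simp only [Set.indicator_apply, hf0, ite_self]
    · simp only [Set.indicator_apply, hkey g hD]
  have hWm : Measurable fun x : GL (Fin 3) F ⧸ (Subgroup.zpowers (Units.mk0 ϖ hϖ0)).map (Matrix.GeneralLinearGroup.scalar (Fin 3)) => U.indicator f x := by
    rw [hWeq]; exact hfm.indicator hOo.measurableSet
  -- §4 the upstairs dominator
  set w : Matrix (Fin 3) (Fin 3) F → ℝ := fun X => NE.indicator (fun Y => ((normAbs F Y.charpoly.discr : ℝ)) ^ (-(1 / 2 + ε))) X *
    ((normAbs F X.det : ℝ)) ^ (1 + 2 * ε) with hw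
  have hwli : LocallyIntegrableOn w {X : Matrix (Fin 3) (Fin 3) F | IsUnit X} dX :=
    locallyIntegrableOn_indicator_nonell_rpow_neg_mul_det_rpow two_ne_zero dX hε0 hε (1 + 2 * ε)
  -- §5 domination (in fact equality)
  have hle : ∀ g : GL (Fin 3) F, ‖U.indicator f (QuotientGroup.mk g)‖ ≤ w (g : Matrix (Fin 3) (Fin 3) F) := by
    intro g
    have hw0 : 0 ≤ w (g : Matrix (Fin 3) (Fin 3) F) := by
      simp only [hw]
      refine mul_nonneg ?_ (Real.rpow_nonneg (NNReal.coe_nonneg _) _)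
      by_cases hm : (g : Matrix (Fin 3) (Fin 3) F) ∈ NE
      · rw [indicator_of_mem hm]; exact Real.rpow_nonneg (NNReal.coe_nonneg _) _
      · rw [indicator_of_notMem hm]
    by_cases hgU : (QuotientGroup.mk g : GL (Fin 3) F ⧸ (Subgroup.zpowers (Units.mk0 ϖ hϖ0)).map (Matrix.GeneralLinearGroup.scalar (Fin 3))) ∈ U
    · rw [indicator_of_mem hgU]
      by_cases hD : (g : Matrix (Fin 3) (Fin 3) F).charpoly.discr = 0
      · have hδ0 : δ (QuotientGroup.mk g) = 0 := by rw [hδ g, hD, map_zero, zero_div]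
        simp only [hf, hδ0, NNReal.coe_zero, Real.zero_rpow hexp, norm_zero]
        exact hw0
      · -- the regular non-elliptic case: equality
        have hmem : (g : Matrix (Fin 3) (Fin 3) F) ∈ NE := by
          obtain ⟨g', hg', hD', hcard'⟩ := (hkey g hD).1 hgU
          -- `g` itself is non-elliptic: `Z(mk g)` non-compact and `χ_g` separable
          have hsep : (g : Matrix (Fin 3) (Fin 3) F).charpoly.Separable :=
            separable_of_discr_ne_zero (Matrix.charpoly_monic _) (by rw [Matrix.charpoly_natDegree_eq_dim, Fintype.card_fin]; norm_num) hD
          have hirr : ¬ Irreducible (g : Matrix (Fin 3) (Fin 3) F).charpoly := fun hirr =>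
            hgU ((isCompact_centralizer_mk_iff_irreducible hϖ hϖ0 g hsep).2 hirr)
          rw [irreducible_charpoly_iff_card_roots_eq_zero] at hirr
          refine ⟨hD, ?_⟩
          rcases card_roots_charpoly_eq_zero_or_one_or_three (g : Matrix (Fin 3) (Fin 3) F) with h | h | h
          · exact absurd h hirr
          · exact Or.inr h
          · exact Or.inl h
        have ha : 0 < (normAbs F (g : Matrix (Fin 3) (Fin 3) F).charpoly.discr : ℝ) :=
          NNReal.coe_pos.2 (pos_iff_ne_zero.2 ((map_ne_zero (normAbs F)).2 hD))
        have hb : 0 < (normAbs F (g : Matrix (Fin 3) (Fin 3) F).det : ℝ) :=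
          NNReal.coe_pos.2 (pos_iff_ne_zero.2 ((map_ne_zero (normAbs F)).2 ((Matrix.isUnit_iff_isUnit_det _).1 g.isUnit).ne_zero))
        have hval : f (QuotientGroup.mk g) = w (g : Matrix (Fin 3) (Fin 3) F) := by
          simp only [hf, hw, indicator_of_mem hmem]
          rw [hδ g, NNReal.coe_div, NNReal.coe_pow, Real.div_rpow ha.le (pow_nonneg hb.le 2), div_eq_mul_inv,
            ← Real.rpow_neg (pow_nonneg hb.le 2), neg_neg, ← Real.rpow_natCast _ 2, ← Real.rpow_mul hb.le]
          congr 1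
          norm_num; ring_nf
        rw [hval, Real.norm_of_nonneg hw0]
    · rw [indicator_of_notMem hgU, norm_zero]
      exact hw0
  -- §6 transport to `G'`
  exact locallyIntegrable_of_norm_comp_mk_le hϖ hϖ0 dX ρ μ' hwli hWm.aestronglyMeasurable
    (hWm.comp QuotientGroup.continuous_mk.measurable).aestronglyMeasurable hle

end Quotient

end Summit.HodgeConjecture.HodgeConjecture.Cruxes.H413.K2E3GL3NonEllWeightLocIntegrable

end
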